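import Summits.QuantumFields.BalabanUV.Beta.FP.RemainderSymbolChainN
import Summits.QuantumFields.BalabanUV.Beta.FP.RemainderSymbolSlice
import Summits.QuantumFields.BalabanUV.Beta.FP.InverseSymbolDerivN
import Literature.Barriers.CriticalPhenomena.LaceExpansionSymbolCalculus

/-!
# `BalabanUV.Beta.FP.RemainderSymbolSliceN` — road «FP» for binder row D1, leaf H2-P of the horizontal route, sub-row H2-P-CHAIN-N (owner assignment
# 2026-08-20, R-FP-21 (B2)), PART 3: the derivative chain of the REMAINDER SYMBOL `B_w = (feynMat w p̂)⁻¹ − 𝟙∕|p̂|²` of a weighted, Feynman-completed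
# Maxwell symbol along a coordinate slice of the Brillouin zone AT EVERY ORDER — members, identification of order zero with the symbol, and the chain
# `(remSlN n)′ = remSlN (n+1)` for `n < N` under LOCAL (`ContDiffOn` on an open `U ∋ t`) weight hypotheses.

HONEST DEPENDENCY (page 1, mandatory): continuum YM on T⁴ ⇐ BetaPertH ∧ nine spine estimates (0/9 proved); BetaPertH ⇐ (D1) ∧ (D4) ∧ CAP+tail;
G-an2-4 gates asym, D1 and NE2/3/4.  HONEST FRAMING (cell contract, verbatim): «discharging `BetaPertH` makes Bałaban's UV stability UNCONDITIONAL —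
a real constructive-QFT result; it is NOT the continuum limit and NOT the Clay problem.»  THIS MODULE DISCHARGES NOTHING of the wall: [folklore] one-variable
calculus — it COMPOSES, by name, `FP/RemainderSymbolChainN.bSlN` (this lineage: the abstract triple-product chain), `FP/InverseSymbolDerivN`
(gan24-formalise-leaf-01-g47: the inverse members `iteratedDeriv j (A⁻¹)` and `iteratedDeriv j (f⁻¹)`, their chains, `hasDerivAt_iteratedDeriv_of_contDiffAt`),
`FP/RemainderSymbolSlice` (gan24-formalise-leaf-05-g34: the curves `feynSl`, `excSl`, `remSl0` and `remSl0_eq_sub_free`), `FP/DispersionSliceChain` (`fD`,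
`fD_eq`, `fD_pos`) and `Literature/Barriers/CriticalPhenomena/LaceExpansionSymbolCalculus.iteratedDeriv_cos_affine` (`(cos(as+b))^{(j)}`).
0 `def … : Prop`; nothing cited; 0 sorry; 0 wall binders; NOT D1, NOT BetaPertH, NOT continuum, NOT Clay.

ABSOLUTE RULE (cell charter, verbatim): «No internally-minted statement may enter as a cited fact. Every hypothesis is either kernel-proved in this package or a
verbatim quotation of a PUBLISHED theorem with page reference. The manuscript(s) under audit are NOT citable for their own disputed steps — they are the thing
under adjudication; programme-internal (2001/route/tribunal) claims are never citable.»

WHY.  `FP/RemainderSymbolSlice` types the chain of `B_w` along a slice to order 3 (`remSl0…3`) under a GLOBAL `ContDiff ℝ 3` weight row; the kernel letters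
(K2)/(K3) of H2-P-KER-ASM need orders 4, 5 (R-FP-21 (B)), and the `W_∞` weight slices are only `ContDiffOn` on `|u| < π + δ₁₆₆` (`FP/PerfectSymbolDeriv`,
`FP/PerfectSymbol166RealLineRe`).  Here: every order, local hypotheses.

WHAT (dimension `d + 1`; weight `w`; base point `s`, direction `i`, transverse part `q := i.removeNth s`; `open scoped Matrix.Norms.Operator` as in
`FP/InverseSymbolDerivN`, so the matrix-valued `iteratedDeriv`s below are literally g47's members).
* §1 members: `feynC w s i u := feynMat (w (update s i u)) (p̂ (update s i u))` (= `feynSl w s i 0 u`), **`invSl w s i j := iteratedDeriv j (feynC w s i)⁻¹`**,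
  **`zSlN s i j u := ↑(iteratedDeriv j (fD q i)⁻¹ u)`**, and **`remSlN w s i α β n := bSlN (invSl w s i) (excSl w s i) (zSlN s i) α β n`**;
  `remSlN_zero_eq_remSl0` (order zero IS leaf-05-g34's `remSl0`, hence the remainder symbol by `remSl0_eq_sub_free`), `remSlN_zero_eq`.
* §2 the dispersion factor at every order: `contDiff_fD` (`C^∞`), `iteratedDeriv_fD_succ` (`(fD q i)^{(k+1)}(t) = −2·cos(t + (k+1)π∕2)`, via
  `LaceExpansionSymbolCalculus.iteratedDeriv_cos_affine`), `norm_iteratedDeriv_fD_le` (`≤ 2·‖p‖^{(2−k)}`, ℕ-truncated, `k ≥ 1`, `p = i.insertNth t q`).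
* §3 **`hasDerivAt_remSlN`**: if the Feynman and excess ENTRIES are `ContDiffAt ℝ N` at `t` along the slice (REG-N supplies this from local weight
  hypotheses — `FP/MaxwellSymbolDerivN` ∕ `FP/PerfectSymbolDerivN`, gan24-p3-g16; kept as displayed pointwise hypotheses here so that this module does
  not depend on the weight bookkeeping), `feynC w s i t` is invertible and `q ∈ BZ d ∖ {0}`, then for `n < N`:
  `HasDerivAt (remSlN w s i α β n) (remSlN w s i α β (n+1) t) t`; the input links `hasDerivAt_invSl_apply`, `hasDerivAt_excSl_at`, `hasDerivAt_zSlN`.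
PART 3b (`FP/RemainderSymbolSliceNBound`) gives the letters `‖remSlN n t‖ ≤ K_n ∕ ‖p‖ⁿ`; PART 3c the `W_∞` instance.

Provenance: binder row D1 formalisation swarm, lineage beta-d1-formalise-leaf-01, gen 8 (prover-b2b-balaban-beta-d1-formalise-leaf-01-g8-0), 2026-08-20;
sub-row H2-P-CHAIN-N of road FP (owner b2b-balaban-beta-d1-p3, GO journal l.21478).
-/

noncomputable section

namespace Summit.QuantumFields.BalabanUV.Beta.FP.RemainderSymbolSliceN

open Complex Finset Set Filter Matrix
open scoped Matrix.Norms.Operator BigOperators ComplexConjugate Topology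
open Literature.MathematicalPhysics.QuantumFieldTheory.Balaban1983to89
open B4ContourShift (BZ)
open B5Prop11Fiber (d1Sym)
open Summit.QuantumFields.BalabanUV.Beta.FP.PerfectPropagatorSymbol (curlRow maxwellMat feynMat)
open Summit.QuantumFields.BalabanUV.Beta.FP.SliceChainN
open Summit.QuantumFields.BalabanUV.Beta.FP.RemainderSymbolChainN
open Summit.QuantumFields.BalabanUV.Beta.FP.RemainderSymbolChain (X0 zSl0 bSl0)
open Summit.QuantumFields.BalabanUV.Beta.FP.RemainderSymbolSlice (feynSl excSl remSl0 feynSl_zero)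
open Literature.Probability.LatticeModels (dispersion)
open Summit.QuantumFields.BalabanUV.Beta.FP.DispersionSliceChain (fD fD_eq fD_pos)
open Summit.QuantumFields.BalabanUV.Beta.FP.SliceReciprocalChain (rc0)
open Summit.QuantumFields.BalabanUV.Beta.FP.InverseSymbolDerivN (contDiffAt_matrix_of_entries hasDerivAt_iteratedDeriv_matrix_inv_apply
  contDiffAt_inv_real hasDerivAt_iteratedDeriv_inv_real hasDerivAt_iteratedDeriv_of_contDiffAt)

variable {d : ℕ}

/-! ## §1 The members -/

section Defs

variable (w : Fin (d + 1) → Fin (d + 1) → (Fin (d + 1) → ℝ) → ℝ) (s : Fin (d + 1) → ℝ) (i : Fin (d + 1))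

/-- [our object] the Feynman-completed weighted Maxwell matrix along the slice, as a matrix-valued curve. -/
def feynC (u : ℝ) : Matrix (Fin (d + 1)) (Fin (d + 1)) ℂ :=
  feynMat (fun μ ν => w μ ν (Function.update s i u)) (d1Sym (Function.update s i u))

/-- [our object] **THE INVERSE MEMBERS** `invSl j := (feynC)⁻¹` differentiated `j` times (Mathlib `iteratedDeriv`, operator-norm instances — the members of
`FP/InverseSymbolDerivN`). -/
def invSl (j : ℕ) (u : ℝ) : Matrix (Fin (d + 1)) (Fin (d + 1)) ℂ :=
  iteratedDeriv j (fun v => (feynC w s i v)⁻¹) u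

/-- [our object] **THE RECIPROCAL-DISPERSION MEMBERS** `zSlN j := (1∕(2ε))^{(j)}` along the slice, as complex numbers. -/
def zSlN (j : ℕ) (u : ℝ) : ℂ :=
  ((iteratedDeriv j (fun v => (fD (i.removeNth s) i v)⁻¹) u : ℝ) : ℂ)

/-- [our object] **THE REMAINDER-SYMBOL MEMBERS AT EVERY ORDER** along the slice: `remSlN α β n := bSlN invSl excSl zSlN α β n`. -/
def remSlN (α β : Fin (d + 1)) (n : ℕ) (u : ℝ) : ℂ :=
  bSlN (invSl w s i) (excSl w s i) (zSlN s i) α β n u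

/-- [folklore] the curve is the order-zero `feynSl`. -/
theorem feynC_eq_feynSl_zero : feynC w s i = feynSl w s i 0 := by
  funext u; rw [feynSl_zero]; rfl

/-- [folklore] the order-zero inverse member is `X0 (feynSl 0) = (feynSl 0 ·)⁻¹`. -/
theorem invSl_zero : invSl w s i 0 = X0 (feynSl w s i 0) := by
  funext u
  simp only [invSl, iteratedDeriv_zero, X0, feynC_eq_feynSl_zero]

/-- [folklore] the order-zero reciprocal member is `zSl0 (fD q i)`. -/
theorem zSlN_zero : zSlN s i 0 = zSl0 (fD (i.removeNth s) i) := by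
  funext u
  simp only [zSlN, iteratedDeriv_zero, zSl0, rc0]

/-- [our object] **ORDER ZERO IS `remSl0`** (leaf-05-g34's remainder-symbol slice; hence, by `RemainderSymbolSlice.remSl0_eq_sub_free`, the remainder
symbol `((feynMat …)⁻¹) α β − [α = β]∕|p̂|²` itself). -/
theorem remSlN_zero_eq_remSl0 (α β : Fin (d + 1)) (u : ℝ) : remSlN w s i α β 0 u = remSl0 w s i α β u := by
  unfold remSlN remSl0
  exact bSlN_zero_eq_bSl0 (invSl_zero w s i) rfl (zSlN_zero s i) α β u

/-- [folklore] order zero, displayed: `remSlN … 0 u = −(((feynC u)⁻¹ * excSl 0 u) α β * (fD q i u)⁻¹)`. -/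
theorem remSlN_zero_eq (α β : Fin (d + 1)) (u : ℝ) :
    remSlN w s i α β 0 u = -(((feynC w s i u)⁻¹ * excSl w s i 0 u) α β * (((fD (i.removeNth s) i u)⁻¹ : ℝ) : ℂ)) := by
  unfold remSlN
  rw [bSlN_zero]
  simp [invSl, zSlN]

/-- [folklore] base-point invariance: the members depend on `s` only through the line `{update s i u}`. -/
theorem feynC_update (t₀ : ℝ) : feynC w (Function.update s i t₀) i = feynC w s i := by
  funext u; simp [feynC, Function.update_idem]

end Defs

/-! ## §2 The dispersion factor at every order -/

section Dispersion

variable (q : Fin d → ℝ) (i : Fin (d + 1))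

/-- [folklore] `fD q i` is `C^∞` (closed form `(2 − 2cos t) + 2·ε(q)`, `DispersionSliceChain.fD_eq`). -/
theorem contDiff_fD {n : WithTop ℕ∞} : ContDiff ℝ n (fD q i) := by
  have e : fD q i = fun t => (2 - 2 * Real.cos t) + 2 * dispersion q := by funext t; exact fD_eq q i t
  rw [e]
  exact ((contDiff_const.sub (contDiff_const.mul Real.contDiff_cos)).add contDiff_const)

/-- [folklore] the higher derivatives of the dispersion slice: `(fD q i)^{(k+1)}(t) = −2·cos(t + (k+1)·π∕2)`. -/
theorem iteratedDeriv_fD_succ (k : ℕ) (t : ℝ) :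
    iteratedDeriv (k + 1) (fD q i) t = -2 * Real.cos (t + ((k + 1 : ℕ) : ℝ) * (Real.pi / 2)) := by
  have e : fD q i = fun t => (2 + 2 * dispersion q) + (-2) * Real.cos (1 * t + 0) := by
    funext t; rw [fD_eq]; ring_nf
  rw [e, iteratedDeriv_const_add (Nat.succ_pos k), iteratedDeriv_const_mul (c := (-2 : ℝ))
    ((Literature.Barriers.CriticalPhenomena.contDiff_cos_affine 1 0).contDiffAt),
    Literature.Barriers.CriticalPhenomena.iteratedDeriv_cos_affine]
  push_cast
  ring_nf

/-- [folklore] **THE DISPERSION LETTERS, ALL ORDERS** (`InverseSymbolDerivN`'s truncated currency, `c = 2`): for `k ≥ 1` and `p := i.insertNth t q`,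
`‖(fD q i)^{(k)}(t)‖ ≤ 2·‖p‖^{(2−k)}` (ℕ-truncated exponent: `2‖p‖` at `k = 1` by `|sin t| ≤ |t| ≤ ‖p‖`, and `2` for `k ≥ 2`). -/
theorem norm_iteratedDeriv_fD_le (t : ℝ) :
    ∀ k, 1 ≤ k → ‖iteratedDeriv k (fD q i) t‖ ≤ 2 * ‖(i.insertNth t q : Fin (d + 1) → ℝ)‖ ^ (2 - k) := by
  intro k hk
  obtain ⟨m, rfl⟩ : ∃ m, k = m + 1 := ⟨k - 1, by omega⟩
  rw [iteratedDeriv_fD_succ, Real.norm_eq_abs]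
  rcases Nat.eq_zero_or_pos m with h0 | hpos
  · subst h0
    have e : -2 * Real.cos (t + ((0 + 1 : ℕ) : ℝ) * (Real.pi / 2)) = 2 * Real.sin t := by
      simp only [Nat.zero_add, Nat.cast_one, one_mul]
      rw [Real.cos_add_pi_div_two]; ring
    rw [e, show (2 - (0 + 1) : ℕ) = 1 from rfl, pow_one, abs_mul, abs_two]
    refine mul_le_mul_of_nonneg_left ?_ (by norm_num)
    calc |Real.sin t| ≤ |t| := Real.abs_sin_le_abs
      _ = ‖(i.insertNth t q : Fin (d + 1) → ℝ) i‖ := by simp [Fin.insertNth_apply_same, Real.norm_eq_abs]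
      _ ≤ ‖(i.insertNth t q : Fin (d + 1) → ℝ)‖ := norm_le_pi_norm _ i
  · have hsub : 2 - (m + 1) = 0 := by omega
    rw [hsub, pow_zero, mul_one, abs_mul]
    calc |(-2 : ℝ)| * |Real.cos (t + ((m + 1 : ℕ) : ℝ) * (Real.pi / 2))| ≤ 2 * 1 := by
          rw [abs_neg, abs_two]; exact mul_le_mul_of_nonneg_left (Real.abs_cos_le_one _) (by norm_num)
      _ = 2 := by ring

end Dispersion

/-! ## §3 The chain at every order -/

section Chain

variable {w : Fin (d + 1) → Fin (d + 1) → (Fin (d + 1) → ℝ) → ℝ} {s : Fin (d + 1) → ℝ} {i : Fin (d + 1)} {t : ℝ} {N : ℕ}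
  (hfeyn : ∀ γ β, ContDiffAt ℝ N (fun u : ℝ => feynMat (fun μ ν => w μ ν (Function.update s i u)) (d1Sym (Function.update s i u)) γ β) t)
  (hexc : ∀ γ β, ContDiffAt ℝ N (fun u : ℝ => maxwellMat (fun μ ν => w μ ν (Function.update s i u) - 1) (d1Sym (Function.update s i u)) γ β) t)
  (hdet : IsUnit (feynC w s i t).det)
  (hq : i.removeNth s ∈ BZ d) (hq0 : i.removeNth s ≠ 0)

include hfeyn in
/-- [folklore] the Feynman curve is `C^N` at `t` as a MATRIX-valued map (`InverseSymbolDerivN.contDiffAt_matrix_of_entries`). -/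
theorem contDiffAt_feynC : ContDiffAt ℝ N (feynC w s i) t :=
  contDiffAt_matrix_of_entries fun γ β => hfeyn γ β

include hfeyn hdet in
/-- [our object] the INVERSE links, entrywise: `(invSl j · γ δ)′(t) = invSl (j+1) t γ δ` for `j < N` (g47's `hasDerivAt_iteratedDeriv_matrix_inv_apply`). -/
theorem hasDerivAt_invSl_apply {j : ℕ} (hj : j < N) (γ δ : Fin (d + 1)) :
    HasDerivAt (fun u => invSl w s i j u γ δ) (invSl w s i (j + 1) t γ δ) t :=
  hasDerivAt_iteratedDeriv_matrix_inv_apply (contDiffAt_feynC hfeyn) hdet hj γ δ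

include hexc in
/-- [our object] the EXCESS links, entrywise: `(excSl j · γ β)′(t) = excSl (j+1) t γ β` for `j < N` (`InverseSymbolDerivN.hasDerivAt_iteratedDeriv_of_contDiffAt`). -/
theorem hasDerivAt_excSl_at {j : ℕ} (hj : j < N) (γ β : Fin (d + 1)) :
    HasDerivAt (fun u => excSl w s i j u γ β) (excSl w s i (j + 1) t γ β) t :=
  hasDerivAt_iteratedDeriv_of_contDiffAt (hexc γ β) hj

include hq hq0 in
/-- [our object] the RECIPROCAL-DISPERSION links: `(zSlN j)′(t) = zSlN (j+1) t` for every `j` (`fD` is `C^∞` and positive on slices missing the origin). -/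
theorem hasDerivAt_zSlN (j : ℕ) : HasDerivAt (zSlN s i j) (zSlN s i (j + 1) t) t := by
  have hf : ContDiffAt ℝ (j + 1 : ℕ) (fD (i.removeNth s) i) t := (contDiff_fD (i.removeNth s) i).contDiffAt
  have h := hasDerivAt_iteratedDeriv_inv_real hf (fD_pos hq hq0 i t).ne' (Nat.lt_succ_self j)
  exact h.ofReal_comp

include hfeyn hexc hdet hq hq0 in
/-- [our object] **THE CHAIN AT EVERY ORDER**: for `n < N`, `(remSlN w s i α β n)′(t) = remSlN w s i α β (n+1) t`. -/
theorem hasDerivAt_remSlN {n : ℕ} (hn : n < N) (α β : Fin (d + 1)) :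
    HasDerivAt (remSlN w s i α β n) (remSlN w s i α β (n + 1) t) t := by
  unfold remSlN
  exact hasDerivAt_bSlN (fun j hj γ δ => hasDerivAt_invSl_apply hfeyn hdet (lt_of_le_of_lt hj hn) γ δ)
    (fun j hj γ δ => hasDerivAt_excSl_at hexc (lt_of_le_of_lt hj hn) γ δ) (fun j _ => hasDerivAt_zSlN hq hq0 j) α β

end Chain

end Summit.QuantumFields.BalabanUV.Beta.FP.RemainderSymbolSliceN

end
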